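import Literature.RingTheory.FormalGroups.FormalGroupHom
import Literature.RingTheory.FormalGroups.FormalGroupCoefficients   -- ★ `coeff_single_zero_formalGroup` (`F(X,0) = X` coefficientwise)
import Mathlib.RingTheory.PowerSeries.Derivative
import Mathlib.RingTheory.PowerSeries.Inverse
import Mathlib.Algebra.DualNumber
import Mathlib.Algebra.Polynomial.Taylor
import HarnessLib

/-!
# The derivative of a homomorphism of one-dimensional formal group laws: `φ′·∂_Y F(X,0) = φ′(0)·∂_Y G(φ X, 0)`
# ([Fröhlich 1968] Ch. I §3, proof of Thm. 2; [Hazewinkel 1978] §18.3; [Harris–Taylor 2001] §II.1)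

Topic `Literature/RingTheory/FormalGroups`; namespace `Literature.RingTheory.FormalGroups`.  THEOREMS ONLY (no definition,
no named fact, no instance, no notation, no `sorry`); carrier = Mathlib `FormalGroup` + ★ `FormalGroupHom`.  Cell
`hodgecm-mathlib`, P6 «MOD programme», sub-desk F0P6d: generic organ (K-org2, first file) under the letter (HL-A)
`HeightDichotomy` of `Cruxes/HLiu418/Lines/F0_P6d_FormalModuleKernels.lean` («`[ϖ]_F = 0` or `[ϖ]_F(X) = g(X^{q^h})`,
`g′(0) ≠ 0`»): its first step is «a homomorphism with `φ′(0) = 0` has `φ′ = 0`», which in characteristic `p` gives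
`φ(X) = φ₁(X^p)` (sequel file `FormalGroupHomFrobenius`).  HC_CM is proved only modulo the printed citations until rung 0
closes; nothing here is about HC.

THE PRINT.  [Frohlich1968] Ch. I §3 (Thm. 2 and its proof): for a homomorphism `f : F → G` of one-dimensional formal group
laws, differentiating `f(F(X,Y)) = G(f X, f Y)` with respect to `Y` at `Y = 0` gives
`f′(X) · F_Y(X, 0) = G_Y(f(X), 0) · f′(0)`; since `F_Y(X, 0) = 1 + …` is a unit, `f′(0) = 0` forces `f′ = 0`, whence over a
ring of characteristic `p`, `f(X) = f₁(X^p)`; iterating, `f(X) = g(X^{p^h})` with `g′(0) ≠ 0` (the HEIGHT of `f`).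
[Hazewinkel1978] §18.3 (18.3.1)–(18.3.3) is the same computation; [HarrisTaylorAMS2001] §II.1 (p. 59) uses the normal form
`[ϖ](X) = g(X^{q^h})` for formal `𝒪`-modules.

THE PROOF HERE (no partial derivatives of bivariate series are needed): base-change to the DUAL NUMBERS `R[ε]`
(`Mathlib.Algebra.DualNumber`, `ε² = 0`) and evaluate the homomorphism identity (★ `FormalGroupHom.map_add'`, every currency)
at the pair `(X, εX)`: with the FIRST-ORDER TAYLOR FORMULA for substitution `φ(g + δ) = φ(g) + δ·φ′(g)` (`δ² = 0`;
`subst_add_of_sq_eq_zero`, from Mathlib's polynomial case `Polynomial.aeval_add_of_sq_eq_zero` by truncation) and the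
first-order `X₁`-ADIC EXPANSION `H(X₀, X₁) = H(X₀, 0) + X₁·H₁(X₀) + X₁²·K` (`exists_eq_add_X_mul_add_X_sq_mul`, hence
`H(u, w) = H(u, 0) + w·H₁(u)` for `w² = 0`, `subst_pair_of_sq_eq_zero`) both sides become `φ + ε·X·(…)`, and the `ε`-parts
give the identity (`eq_of_eps_mul_X_mul_map_eq`).

MAIN STATEMENTS (public, cited): §2 `FormalGroup.mk_coeff_single_zero` (`F(X, 0) = X` on the coefficient extraction, over ★
`FormalGroupCoefficients.coeff_single_zero_formalGroup`); §4 `FormalGroupHom.constantCoeff_partialY`, `FormalGroupHom.isUnit_partialY`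
(`∂F/∂Y (X, 0) ∈ R⟦X⟧ˣ`), **`FormalGroupHom.derivative_mul_partialY`** (THE IDENTITY) and
**`FormalGroupHom.derivative_eq_zero_of_coeff_one_eq_zero`** (`φ′(0) = 0 ⇒ φ′ = 0`).  Private plumbing ([folklore]): §1
`coeff_subst_eq_coeff_trunc_subst`, `subst_add_of_sq_eq_zero` (Taylor to first order); §2 `coeff_powerSeries_subst_X_zero`,
`exists_eq_add_X_mul_add_X_sq_mul`; §3 `subst_pair_of_sq_eq_zero`; §4 `derivative_map`, `mk_coeff_map`,
`powerSeries_map_subst`, `eq_of_eps_mul_X_mul_map_eq`.  The series `∂F/∂Y (X, 0)` is written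
`PowerSeries.mk fun n => MvPowerSeries.coeff (single 0 n + single 1 1) F.toPowerSeries` throughout (no definition is introduced).

## References
* [Frohlich1968] A. Fröhlich, *Formal Groups*, LNM 74 (1968), Ch. I §3, Thm. 2 and its proof.
* [Hazewinkel1978] M. Hazewinkel, *Formal Groups and Applications* (1978), §18.3, (18.3.1)–(18.3.3).
* [HarrisTaylorAMS2001] M. Harris, R. Taylor, *The Geometry and Cohomology of Some Simple Shimura Varieties*, Ann. of Math.
  Stud. 151 (2001), §II.1 (p. 59).
-/

noncomputable section

namespace Literature.RingTheory.FormalGroups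

open _root_.MvPowerSeries (HasSubst subst)
open scoped DualNumber

universe u v

variable {R : Type u} [CommRing R] {S : Type v} [CommRing S]

/-! ## §1 Calculus of univariate substitution: truncation and the first-order Taylor formula -/

/-- Coefficients of `φ(g)` below `n` only see the truncation of `φ` at any `m` beyond which `g^d` has no coefficients
below `n`. [folklore] -/
private theorem coeff_subst_eq_coeff_trunc_subst [Algebra R S] (φ : PowerSeries R) {g : PowerSeries S}
    (hg : PowerSeries.HasSubst g) {n m : ℕ} (hm : ∀ d, m ≤ d → ∀ n' ≤ n, PowerSeries.coeff n' (g ^ d) = 0) :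
    PowerSeries.coeff n (φ.subst g) =
      PowerSeries.coeff n (((PowerSeries.trunc m φ : Polynomial R) : PowerSeries R).subst g) := by
  rw [PowerSeries.coeff_subst' hg, PowerSeries.coeff_subst' hg]
  refine finsum_congr fun d => ?_
  by_cases hd : d < m
  · rw [Polynomial.coeff_coe, PowerSeries.coeff_trunc, if_pos hd]
  · rw [hm d (not_lt.mp hd) n le_rfl, smul_zero, smul_zero]

/-- **First-order Taylor formula for substitution**: if `δ² = 0` then `φ(g + δ) = φ(g) + δ·φ′(g)`.
(Mathlib has the polynomial case `Polynomial.aeval_add_of_sq_eq_zero`; the power-series case follows by truncation.)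
[folklore] -/
private theorem subst_add_of_sq_eq_zero [Algebra R S] (φ : PowerSeries R) {g δ : PowerSeries S}
    (hg : PowerSeries.HasSubst g) (hδ : δ ^ 2 = 0) :
    φ.subst (g + δ) = φ.subst g + δ * (PowerSeries.derivative R φ).subst g := by
  have hδ' : PowerSeries.HasSubst δ :=
    ⟨2, by rw [← map_pow, hδ, map_zero]⟩
  have hgδ : PowerSeries.HasSubst (g + δ) := hg.add hδ'
  ext n
  obtain ⟨m, hm⟩ := ((hgδ.eventually_coeff_pow_eq_zero n).and
    (hg.eventually_coeff_pow_eq_zero n)).exists_forall_of_atTop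
  -- replace `φ` by its truncation `P` at `m + 1`
  set P : Polynomial R := PowerSeries.trunc (m + 1) φ with hP
  have h1 : PowerSeries.coeff n (φ.subst (g + δ)) = PowerSeries.coeff n ((P : PowerSeries R).subst (g + δ)) :=
    coeff_subst_eq_coeff_trunc_subst φ hgδ fun d hd n' hn' => (hm d (by omega)).1 n' hn'
  have h2 : PowerSeries.coeff n (φ.subst g) = PowerSeries.coeff n ((P : PowerSeries R).subst g) :=
    coeff_subst_eq_coeff_trunc_subst φ hg fun d hd n' hn' => (hm d (by omega)).2 n' hn'
  have h3 : ∀ j ≤ n, PowerSeries.coeff j ((PowerSeries.derivative R φ).subst g) =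
      PowerSeries.coeff j (((Polynomial.derivative P : Polynomial R) : PowerSeries R).subst g) := by
    intro j hj
    rw [hP, ← PowerSeries.trunc_derivative]
    exact coeff_subst_eq_coeff_trunc_subst _ hg fun d hd n' hn' => (hm d hd).2 n' (hn'.trans hj)
  have h4 : PowerSeries.coeff n (δ * (PowerSeries.derivative R φ).subst g) =
      PowerSeries.coeff n (δ * ((Polynomial.derivative P : Polynomial R) : PowerSeries R).subst g) := by
    rw [PowerSeries.coeff_mul, PowerSeries.coeff_mul]
    refine Finset.sum_congr rfl fun ⟨i, j⟩ hij => ?_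
    rw [h3 j (by
      have := Finset.mem_antidiagonal.mp hij
      simp only at this
      omega)]
  rw [map_add, h1, h2, h4, PowerSeries.subst_coe hgδ, PowerSeries.subst_coe hg, PowerSeries.subst_coe hg,
    Polynomial.aeval_add_of_sq_eq_zero P g δ hδ, map_add, mul_comm]

/-! ## §2 The `X₁`-adic expansion of a bivariate series to first order -/

/-- Coefficients of a univariate series `A(X₀)` viewed in `R⟦X₀, X₁⟧`. [folklore] -/
private theorem coeff_powerSeries_subst_X_zero (A : PowerSeries R) (m : Fin 2 →₀ ℕ) :
    MvPowerSeries.coeff m (A.subst (MvPowerSeries.X 0 : MvPowerSeries (Fin 2) R)) =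
      if m 1 = 0 then PowerSeries.coeff (m 0) A else 0 := by
  classical
  rw [PowerSeries.coeff_subst (PowerSeries.HasSubst.X 0), finsum_eq_single _ (m 0)]
  · rw [MvPowerSeries.coeff_X_pow]
    by_cases h1 : m 1 = 0
    · have hm : m = Finsupp.single 0 (m 0) := by
        ext i; fin_cases i <;> simp [h1]
      rw [if_pos hm, if_pos h1, smul_eq_mul, mul_one]
    · have hm : m ≠ Finsupp.single 0 (m 0) := by
        intro hm; apply h1; rw [hm]; simp
      rw [if_neg hm, if_neg h1, smul_zero]
  · intro d hd
    rw [MvPowerSeries.coeff_X_pow, if_neg, smul_zero]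
    intro hm; apply hd; rw [hm]; simp

/-- **First-order expansion in `X₁`**: every `H ∈ R⟦X₀, X₁⟧` is `H(X₀, 0) + X₁·(∂H/∂X₁)(X₀, 0) + X₁²·K`. [folklore] -/
private theorem exists_eq_add_X_mul_add_X_sq_mul (H : MvPowerSeries (Fin 2) R) :
    ∃ K : MvPowerSeries (Fin 2) R,
      H = (PowerSeries.mk fun n => MvPowerSeries.coeff (Finsupp.single 0 n) H).subst (MvPowerSeries.X 0) +
        MvPowerSeries.X 1 * (PowerSeries.mk fun n =>
          MvPowerSeries.coeff (Finsupp.single 0 n + Finsupp.single 1 1) H).subst (MvPowerSeries.X 0) +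
        MvPowerSeries.X 1 ^ 2 * K := by
  classical
  set H₀ : PowerSeries R := PowerSeries.mk fun n => MvPowerSeries.coeff (Finsupp.single 0 n) H with hH₀
  set H₁ : PowerSeries R := PowerSeries.mk fun n =>
    MvPowerSeries.coeff (Finsupp.single 0 n + Finsupp.single 1 1) H with hH₁
  -- step 1: `X₁ ∣ H − H₀`
  have hdvd : (MvPowerSeries.X 1 : MvPowerSeries (Fin 2) R) ∣ H - H₀.subst (MvPowerSeries.X 0) := by
    rw [MvPowerSeries.X_dvd_iff]
    intro m hm
    have hm' : m = Finsupp.single 0 (m 0) := by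
      ext i; fin_cases i <;> simp [hm]
    rw [map_sub, coeff_powerSeries_subst_X_zero, if_pos hm, hH₀, PowerSeries.coeff_mk, ← hm', sub_self]
  obtain ⟨H', hH'⟩ := hdvd
  -- step 2: `X₁ ∣ H′ − H₁`
  have hcoeff : ∀ m : Fin 2 →₀ ℕ, MvPowerSeries.coeff m H' = MvPowerSeries.coeff (m + Finsupp.single 1 1) H -
      MvPowerSeries.coeff (m + Finsupp.single 1 1) (H₀.subst (MvPowerSeries.X 0)) := by
    intro m
    rw [← map_sub, hH', MvPowerSeries.X_def, add_comm m, MvPowerSeries.coeff_add_monomial_mul, one_mul]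
  have hdvd' : (MvPowerSeries.X 1 : MvPowerSeries (Fin 2) R) ∣ H' - H₁.subst (MvPowerSeries.X 0) := by
    rw [MvPowerSeries.X_dvd_iff]
    intro m hm
    have hm' : m + Finsupp.single 1 1 = Finsupp.single 0 (m 0) + Finsupp.single 1 1 := by
      ext i; fin_cases i <;> simp [hm]
    rw [map_sub, hcoeff m, coeff_powerSeries_subst_X_zero, coeff_powerSeries_subst_X_zero, if_neg (by simp), if_pos hm, hH₁,
      PowerSeries.coeff_mk, hm', sub_zero, sub_self]
  obtain ⟨K, hK⟩ := hdvd'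
  refine ⟨K, ?_⟩
  have hH : H = H₀.subst (MvPowerSeries.X 0) + MvPowerSeries.X 1 * H' := by rw [← hH', add_sub_cancel]
  have hH'' : H' = H₁.subst (MvPowerSeries.X 0) + MvPowerSeries.X 1 * K := by rw [← hK, add_sub_cancel]
  rw [hH, hH'']
  ring

/-- For a formal group law, `F(X, 0) = X` read on the coefficient extraction `H₀`: `Σₙ [X₀ⁿ]F · Xⁿ = X`
(★ `coeff_single_zero_formalGroup`). [cite: Hazewinkel1978, §1.1 (1.1.2)] -/
theorem FormalGroup.mk_coeff_single_zero (F : FormalGroup R) :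
    (PowerSeries.mk fun n => MvPowerSeries.coeff (Finsupp.single 0 n) F.toPowerSeries) = PowerSeries.X := by
  ext n
  rw [PowerSeries.coeff_mk, coeff_single_zero_formalGroup, PowerSeries.coeff_X]

/-! ## §3 Substituting a pair whose second entry squares to zero -/

/-- **`H(u, w) = H(u, 0) + w·(∂H/∂X₁)(u, 0)` when `w² = 0`.** [folklore] -/
private theorem subst_pair_of_sq_eq_zero (H : MvPowerSeries (Fin 2) R) {u w : PowerSeries R}
    (hu : PowerSeries.HasSubst u) (hw : w ^ 2 = 0) :
    subst ![u, w] H =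
      (PowerSeries.mk fun n => MvPowerSeries.coeff (Finsupp.single 0 n) H).subst u +
        w * (PowerSeries.mk fun n => MvPowerSeries.coeff (Finsupp.single 0 n + Finsupp.single 1 1) H).subst u := by
  have hw' : PowerSeries.HasSubst w := ⟨2, by rw [← map_pow, hw, map_zero]⟩
  have hb : HasSubst (![u, w] : Fin 2 → PowerSeries R) := hasSubst_pair hu hw'
  obtain ⟨K, hK⟩ := exists_eq_add_X_mul_add_X_sq_mul H
  conv_lhs => rw [hK]
  rw [← MvPowerSeries.coe_substAlgHom hb]
  simp only [map_add, map_mul, map_pow]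
  rw [MvPowerSeries.coe_substAlgHom hb, subst_powerSeries_subst (PowerSeries.HasSubst.X 0) hb,
    subst_powerSeries_subst (PowerSeries.HasSubst.X 0) hb, MvPowerSeries.subst_X hb, MvPowerSeries.subst_X hb]
  simp only [Matrix.cons_val_zero, Matrix.cons_val_one]
  rw [hw, zero_mul, add_zero]


/-! ## §4 The derivative of a homomorphism of formal group laws -/

/-- `d/dX` commutes with coefficientwise maps. [folklore] -/
private theorem derivative_map (f : R →+* S) (φ : PowerSeries R) :
    PowerSeries.derivative S (PowerSeries.map f φ) = PowerSeries.map f (PowerSeries.derivative R φ) := by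
  ext n
  simp only [PowerSeries.coeff_derivative, PowerSeries.coeff_map, map_mul, map_add, map_natCast, map_one]

/-- `PowerSeries.mk` of mapped coefficients is the mapped `PowerSeries.mk` (for the two coefficient extractions used
below). [folklore] -/
private theorem mk_coeff_map (f : R →+* S) (H : MvPowerSeries (Fin 2) R) (e : ℕ → Fin 2 →₀ ℕ) :
    (PowerSeries.mk fun n => MvPowerSeries.coeff (e n) (MvPowerSeries.map f H)) =
      PowerSeries.map f (PowerSeries.mk fun n => MvPowerSeries.coeff (e n) H) := by
  ext n
  rw [PowerSeries.coeff_mk, PowerSeries.coeff_map, PowerSeries.coeff_mk, MvPowerSeries.coeff_map]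

/-- `PowerSeries.map` commutes with univariate substitution (Mathlib's `PowerSeries.map_subst`, restated with
`PowerSeries.map` on the substituted series). [folklore] -/
private theorem powerSeries_map_subst (f : R →+* S) {a : PowerSeries R} (ha : PowerSeries.HasSubst a) (φ : PowerSeries R) :
    PowerSeries.map f (φ.subst a) = (PowerSeries.map f φ).subst (PowerSeries.map f a) := by
  change MvPowerSeries.map f (PowerSeries.subst a φ) = _
  rw [PowerSeries.map_subst ha]
  rfl

/-- In `R[ε]⟦X⟧`, the `ε`-part of `ε·X·u` recovers `u ∈ R⟦X⟧`: `ε X u = ε X v ⇒ u = v`. [folklore] -/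
private theorem eq_of_eps_mul_X_mul_map_eq (u v : PowerSeries R)
    (h : PowerSeries.C (ε : DualNumber R) * PowerSeries.X * PowerSeries.map (algebraMap R (DualNumber R)) u =
      PowerSeries.C (ε : DualNumber R) * PowerSeries.X * PowerSeries.map (algebraMap R (DualNumber R)) v) :
    u = v := by
  ext n
  have h' := congrArg (fun ψ => TrivSqZeroExt.snd (PowerSeries.coeff (n + 1) ψ)) h
  simp only [mul_assoc, PowerSeries.coeff_C_mul, PowerSeries.coeff_succ_X_mul, PowerSeries.coeff_map,
    TrivSqZeroExt.algebraMap_eq_inl, DualNumber.snd_mul, DualNumber.fst_eps, DualNumber.snd_eps,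
    TrivSqZeroExt.snd_inl, TrivSqZeroExt.fst_inl, zero_mul, one_mul, zero_add] at h'
  exact h'

namespace FormalGroupHom

variable {F G : FormalGroup R}

/-- The series `∂F/∂Y (X, 0) = 1 + …` has constant term `1`. [cite: Hazewinkel1978, §1.1 (1.1.2)] -/
theorem constantCoeff_partialY (F : FormalGroup R) :
    PowerSeries.constantCoeff
        (PowerSeries.mk fun n => MvPowerSeries.coeff (Finsupp.single 0 n + Finsupp.single 1 1) F.toPowerSeries) = 1 := by
  rw [← PowerSeries.coeff_zero_eq_constantCoeff_apply, PowerSeries.coeff_mk, Finsupp.single_zero, zero_add,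
    F.lin_coeff_Y]

/-- … hence is a unit of `R⟦X⟧`. [cite: Hazewinkel1978, §1.1 (1.1.2)] -/
theorem isUnit_partialY (F : FormalGroup R) :
    IsUnit (PowerSeries.mk fun n => MvPowerSeries.coeff (Finsupp.single 0 n + Finsupp.single 1 1) F.toPowerSeries) :=
  PowerSeries.isUnit_iff_constantCoeff.mpr (by rw [constantCoeff_partialY]; exact isUnit_one)

/-- **The derivative of a homomorphism** `φ : F → G` of one-dimensional formal group laws over any commutative ring:
`φ′(X) · (∂F/∂Y)(X, 0) = φ′(0) · (∂G/∂Y)(φ(X), 0)` — obtained from `φ(F(X,Y)) = G(φ X, φ Y)` by setting `Y = εX`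
over the dual numbers `R[ε]` (`ε² = 0`) and comparing `ε`-parts (first-order Taylor formula on both sides).
Equivalently `φ^*ω_G = φ′(0)·ω_F` for the normalised invariant differentials.
[cite: Frohlich1968, Ch. I §3 Thm. 2 (proof)] [cite: Hazewinkel1978, (18.3.1)] -/
theorem derivative_mul_partialY (φ : FormalGroupHom F G) :
    PowerSeries.derivative R φ.toPowerSeries *
        (PowerSeries.mk fun n => MvPowerSeries.coeff (Finsupp.single 0 n + Finsupp.single 1 1) F.toPowerSeries) =
      PowerSeries.C (PowerSeries.coeff 1 φ.toPowerSeries) *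
        (PowerSeries.mk fun n =>
            MvPowerSeries.coeff (Finsupp.single 0 n + Finsupp.single 1 1) G.toPowerSeries).subst φ.toPowerSeries := by
  -- notation
  set ι : R →+* DualNumber R := algebraMap R (DualNumber R) with hι
  set F₁ : PowerSeries R :=
    PowerSeries.mk fun n => MvPowerSeries.coeff (Finsupp.single 0 n + Finsupp.single 1 1) F.toPowerSeries with hF₁
  set G₁ : PowerSeries R :=
    PowerSeries.mk fun n => MvPowerSeries.coeff (Finsupp.single 0 n + Finsupp.single 1 1) G.toPowerSeries with hG₁
  set φε : FormalGroupHom (F.map ι) (G.map ι) := φ.map ι with hφε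
  set w : PowerSeries (DualNumber R) := PowerSeries.C (ε : DualNumber R) * PowerSeries.X with hw
  have hε2 : (PowerSeries.C (ε : DualNumber R)) ^ 2 = 0 := by
    rw [← map_pow, pow_two, DualNumber.eps_mul_eps, map_zero]
  have hw2 : w ^ 2 = 0 := by rw [hw, mul_pow, hε2, zero_mul]
  have hwS : PowerSeries.HasSubst w := ⟨2, by rw [← map_pow, hw2, map_zero]⟩
  have hX : PowerSeries.HasSubst (PowerSeries.X : PowerSeries (DualNumber R)) := PowerSeries.HasSubst.X'
  -- the coefficient extractions of the base-changed laws are the base changes of `X`, `F₁`, `G₁`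
  have hF0 : (PowerSeries.mk fun n => MvPowerSeries.coeff (Finsupp.single 0 n) (F.map ι).toPowerSeries) =
      PowerSeries.X := FormalGroup.mk_coeff_single_zero (F.map ι)
  have hG0 : (PowerSeries.mk fun n => MvPowerSeries.coeff (Finsupp.single 0 n) (G.map ι).toPowerSeries) =
      PowerSeries.X := FormalGroup.mk_coeff_single_zero (G.map ι)
  have hF1 : (PowerSeries.mk fun n =>
      MvPowerSeries.coeff (Finsupp.single 0 n + Finsupp.single 1 1) (F.map ι).toPowerSeries) = PowerSeries.map ι F₁ :=
    mk_coeff_map ι F.toPowerSeries _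
  have hG1 : (PowerSeries.mk fun n =>
      MvPowerSeries.coeff (Finsupp.single 0 n + Finsupp.single 1 1) (G.map ι).toPowerSeries) = PowerSeries.map ι G₁ :=
    mk_coeff_map ι G.toPowerSeries _
  -- the homomorphism identity at `(X, εX)` over `R[ε]`
  have key := φε.map_add' hX hwS
  -- left-hand side: `φ(F(X, εX)) = φ(X + εX·F₁) = φ + εX·F₁·φ′`
  have hLin : (F.map ι).toPowerSeries.subst ![PowerSeries.X, w] = PowerSeries.X + w * PowerSeries.map ι F₁ := by
    rw [subst_pair_of_sq_eq_zero _ hX hw2, hF0, hF1, PowerSeries.X_subst, PowerSeries.X_subst]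
  have hδ2 : (w * PowerSeries.map ι F₁) ^ 2 = 0 := by rw [mul_pow, hw2, zero_mul]
  have hL : PowerSeries.subst ((F.map ι).toPowerSeries.subst ![PowerSeries.X, w]) φε.toPowerSeries =
      φε.toPowerSeries + w * PowerSeries.map ι F₁ * PowerSeries.map ι (PowerSeries.derivative R φ.toPowerSeries) := by
    rw [hLin, subst_add_of_sq_eq_zero _ hX hδ2, PowerSeries.X_subst, PowerSeries.X_subst, map_toPowerSeries,
      derivative_map]
  -- the second argument on the right: `φ(εX) = ε·φ′(0)·X`
  have hφw : PowerSeries.subst w φε.toPowerSeries = w * PowerSeries.C (ι (PowerSeries.coeff 1 φ.toPowerSeries)) := by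
    have h := subst_add_of_sq_eq_zero φε.toPowerSeries (PowerSeries.HasSubst.zero' (R := DualNumber R)) hw2
    rw [zero_add, PowerSeries.subst_zero_of_constantCoeff_zero φε.constantCoeff_eq_zero, zero_add,
      PowerSeries.subst_zero_eq_C_constantCoeff, Algebra.algebraMap_self, MvPowerSeries.map_id] at h
    rw [h, ← PowerSeries.coeff_zero_eq_constantCoeff_apply, PowerSeries.coeff_derivative, map_toPowerSeries,
      PowerSeries.coeff_map]
    simp only [Nat.cast_zero, zero_add, mul_one, RingHom.id_apply]
    rfl
  have hw'2 : (w * PowerSeries.C (ι (PowerSeries.coeff 1 φ.toPowerSeries))) ^ 2 = 0 := by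
    rw [mul_pow, hw2, zero_mul]
  -- right-hand side: `G(φ, ε φ′(0) X) = φ + ε φ′(0) X · G₁(φ)`
  have hR : (G.map ι).toPowerSeries.subst ![PowerSeries.subst PowerSeries.X φε.toPowerSeries,
      PowerSeries.subst w φε.toPowerSeries] =
      φε.toPowerSeries + w * PowerSeries.C (ι (PowerSeries.coeff 1 φ.toPowerSeries)) *
        PowerSeries.map ι (G₁.subst φ.toPowerSeries) := by
    rw [PowerSeries.X_subst, hφw, subst_pair_of_sq_eq_zero _ φε.hasSubst hw'2, hG0, hG1,
      PowerSeries.subst_X φε.hasSubst, map_toPowerSeries, ← powerSeries_map_subst ι φ.hasSubst]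
  rw [hL, hR, add_right_inj] at key
  -- compare `ε`-parts
  have key' : PowerSeries.C (ε : DualNumber R) * PowerSeries.X *
      PowerSeries.map ι (F₁ * PowerSeries.derivative R φ.toPowerSeries) =
      PowerSeries.C (ε : DualNumber R) * PowerSeries.X *
        PowerSeries.map ι (PowerSeries.C (PowerSeries.coeff 1 φ.toPowerSeries) * G₁.subst φ.toPowerSeries) := by
    rw [map_mul, map_mul, PowerSeries.map_C, ← mul_assoc, ← mul_assoc, ← hw]
    exact key
  rw [mul_comm]
  exact eq_of_eps_mul_X_mul_map_eq _ _ key'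

/-- **A homomorphism with vanishing linear term has vanishing derivative**: `φ′(0) = 0 ⇒ φ′ = 0` (over any
commutative ring; `∂F/∂Y (X, 0)` is a unit). In characteristic `p` this is the first step of the Frobenius
factorisation `φ(X) = φ₁(X^p)`. [cite: Frohlich1968, Ch. I §3 Thm. 2] [cite: Hazewinkel1978, (18.3.1)] -/
theorem derivative_eq_zero_of_coeff_one_eq_zero (φ : FormalGroupHom F G)
    (h : PowerSeries.coeff 1 φ.toPowerSeries = 0) : PowerSeries.derivative R φ.toPowerSeries = 0 := by
  have key := derivative_mul_partialY φ
  rw [h, map_zero, zero_mul] at key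
  exact (isUnit_partialY F).mul_left_eq_zero.mp key

end FormalGroupHom

end Literature.RingTheory.FormalGroups
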